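import Summits.Schanuel.Schanuel.Theses.RootDecomp1H
import Summits.Schanuel.Schanuel.Theorems.RootDecomp1HProductCells

/-!
# RootDecomp1HStoreys — the GLUE of the round-5 split of `RelTowerSchanuel` (route RootDecomp1H, «Storeys»)

Proves the D-0019 glue item `RelTowerSchanuelGlue` (stmt-Schanuel-29911):
`AlmostProductSchanuel → DeepTowerSchanuel → RelTowerSchanuel`.  Schanuel for `ℚ`-free TOWER tuples relative to the atoms of
their span follows, by strong induction on the rank `n`, from its two STOREYS —
* `AlmostProductSchanuel` (stmt-Schanuel-29909; atomic codimension ≤ 1: `span_ℚ b` contains `n − 1` free atoms `u`; complete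
  them by a coordinate `b j` to a basis `(u, b j)` of the same span — a counterexample at `b` transports to `(u, b j)` by
  `RootDecomp1HProductCells.trdeg_lt_of_span_eq`, and the one-storey statement forbids it), and
* `DeepTowerSchanuel` (stmt-Schanuel-29910; atomic codimension ≥ 2, whose extra sub-tower-minimality hypothesis is exactly the
  induction hypothesis, shorter free towers inside `span_ℚ b` inheriting the fine atoms).
Port of the lens-5 gen-5 hand-off `HOME/decomp-schanuel-lens-5/g5/prover/RootDecomp1HStoreys.port.lean` (= `Storeys.lean` §5.4
`relTowerSchanuel_of_storeys`) by the census seat (prover role): the two LOCAL SHIM defs deleted (route constants since rev 8–10),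
the theorem retyped on the route's glue decl; this file defines nothing; no transcendence input; 0 sorry.
-/

noncomputable section

set_option linter.dupNamespace false
namespace Summit.Schanuel.Schanuel.Theorems.RootDecomp1HStoreys

open Complex Set
open Summit.Schanuel.Schanuel.Theses.RootDecomp1H
open Summit.Schanuel.Schanuel.Theorems.RootDecomp1HProductCells (trdeg_lt_of_span_eq)

variable {n m : ℕ}

/-- Basis completion inside a span: if `span_ℚ b` (`b` free of rank `m + 1`) contains `m` free vectors `u`, some coordinate `b j`
completes `u` to a basis `(u, b j)` with the same span. -/
theorem exists_snoc_span_eq {b : Fin (m + 1) → ℂ} (hli : LinearIndependent ℚ b) {u : Fin m → ℂ}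
    (hu : LinearIndependent ℚ u) (hmem : ∀ j, u j ∈ Submodule.span ℚ (range b)) :
    ∃ j, LinearIndependent ℚ (Fin.snoc u (b j) : Fin (m + 1) → ℂ) ∧
      Submodule.span ℚ (range b) = Submodule.span ℚ (range (Fin.snoc u (b j) : Fin (m + 1) → ℂ)) := by
  haveI := FiniteDimensional.span_of_finite ℚ (Set.finite_range b)
  haveI := FiniteDimensional.span_of_finite ℚ (Set.finite_range u)
  have hex : ∃ j, b j ∉ Submodule.span ℚ (range u) := by
    by_contra hall
    push Not at hall
    have hle : Submodule.span ℚ (range b) ≤ Submodule.span ℚ (range u) :=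
      Submodule.span_le.2 (by rintro _ ⟨j, rfl⟩; exact hall j)
    have h1 := finrank_span_eq_card hli
    have h2 := finrank_span_eq_card hu
    have h3 := Submodule.finrank_mono hle
    simp only [Fintype.card_fin] at h1 h2
    omega
  obtain ⟨j, hj⟩ := hex
  have hli' : LinearIndependent ℚ (Fin.snoc u (b j) : Fin (m + 1) → ℂ) := linearIndependent_finSnoc.2 ⟨hu, hj⟩
  refine ⟨j, hli', ?_⟩
  have hle : Submodule.span ℚ (range (Fin.snoc u (b j) : Fin (m + 1) → ℂ)) ≤ Submodule.span ℚ (range b) := by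
    refine Submodule.span_le.2 ?_
    rw [Fin.range_snoc]
    rintro z (rfl | ⟨i, rfl⟩)
    · exact Submodule.subset_span ⟨j, rfl⟩
    · exact hmem i
  exact (Submodule.eq_of_le_of_finrank_eq hle ((finrank_span_eq_card hli').trans (finrank_span_eq_card hli).symm)).symm

/-- Item stmt-Schanuel-29911 (glue of the split of `RelTowerSchanuel`): `AlmostProductSchanuel → DeepTowerSchanuel →
RelTowerSchanuel`, by strong induction on the rank (the almost-product case re-bases the span, the deep case feeds the
induction hypothesis as sub-tower minimality). -/
theorem relTowerSchanuelGlue_holds : RelTowerSchanuelGlue := by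
  intro hA hD n
  induction n using Nat.strong_induction_on with
  | _ n ih =>
    intro b hT hli hfine
    by_cases hH : ∃ (m : ℕ) (u : Fin m → ℂ), m + 1 = n ∧
        (∀ j, Algebra.trdeg ℚ ↥(IntermediateField.adjoin ℚ ({u j, Complex.exp (u j)} : Set ℂ)) ≤ 1) ∧
          LinearIndependent ℚ u ∧ ∀ j, u j ∈ Submodule.span ℚ (Set.range b)
    · obtain ⟨m, u, hmn, hdep, hu, hmem⟩ := hH
      subst hmn
      obtain ⟨j, hli', hss⟩ := exists_snoc_span_eq hli hu hmem
      by_contra hlt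
      rw [not_le] at hlt
      have hlt' := trdeg_lt_of_span_eq hss hlt
      refine absurd (hA m u (b j) hdep hli' ?_) (not_le.2 hlt')
      intro k v hv hvli hvmem
      exact hfine k v hv hvli fun i => hss ▸ hvmem i
    · refine hD n b hT hli hfine ?_ hH
      intro m hm b' hT' hli' hmem'
      refine ih m hm b' hT' hli' ?_
      intro k v hv hvli hvmem
      exact hfine k v hv hvli fun i =>
        (Submodule.span_le.2 (by rintro _ ⟨i', rfl⟩; exact hmem' i') : Submodule.span ℚ (range b') ≤ _) (hvmem i)

end Summit.Schanuel.Schanuel.Theorems.RootDecomp1HStoreys
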